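import Summits.CriticalPhenomena.Ising3DConformalLimit.Theorems.HyperoctahedralRPInversionUpgradeNormalisedLatticeRP
import Summits.CriticalPhenomena.Ising3DConformalLimit.Theorems.MoebiusLimitExists.Negative.FreeTranslations
import HarnessLib

/-!
# Site-mirror reflection positivity of the critical `ℤ³` correlators for a general lattice mirror,
and the CLUSTER MOVE INEQUALITY it implies
(auxiliary file of stub `clusterMoveIneq_cubic` of line `only-interaction-breaks-moebius` for crux
`MoebiusLimitExists`, item stmt-CriticalPhenomena-1344, route `EnergyNotSigmaSquared`; registered
anchor `rp_criticalCorr`)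

Contents.
* `rp_criticalCorr` (registered): for an involutive automorphism `θ` of `ℤ³` preserving the centred
  boxes and an integer height `ℓ` with `ℓ ∘ θ = −ℓ`, `θ = id` on `{ℓ = 0}` and `|ℓ x − ℓ y| ≤ 1`
  along edges, the Gram form `(z, z') ↦ ⟨∏σ_{θz} ∏σ_{z'}⟩_{β_c}` is positive semidefinite on spin
  monomials supported in the closed half `{ℓ ≥ 0}`. Proof: FILS site positivity H1–H3 of the free
  finite-volume measures for the half `P = {ℓ ≥ 0}` (the tree's
  `isingExpect_free_reflect_mul_self_nonneg`), expanded on combinations of spin monomials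
  (`sum_sum_mul_isingExpect_free_rp_nonneg`), then the box limit at `β_c`
  (`criticalCorr_wellDefined_holds`).
* `criticalCorr_comp_equiv`: invariance of `criticalCorr 3` under a box-preserving automorphism
  (`isingCorr_map_equiv` term by term along the boxes); `criticalCorr_comp_involutive`,
  `rp_of_involutive`: the same two facts for an involutive map given as a bare function.
* `criticalCorr_conj_translate`, `rp_conj_translate`: both facts pass to the conjugate mirror
  `v ↦ Θ (v − w) + w` at any lattice height (`criticalCorr_translate`).
* `clusterMoveIneq_of_rp`: for such a pair `(Θ, φ)` — `Θ` involutive, `φ ∘ Θ = −φ`, `criticalCorr`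
  `Θ`-invariant, Gram form PSD on `{φ ≥ 0}` — and a configuration `(y_A, y_B)` with the cluster
  `y_A` in `{φ ≤ 0}`, the block `y_B` in `{φ ≥ 0}`, `y'_A` differing from `y_A` at one index only:
  `(⟨Πσ_{y_A}Πσ_{y_B}⟩ − ⟨Πσ_{y'_A}Πσ_{y_B}⟩)² ≤ [⟨S_AΘS_A⟩ − 2⟨S_AΘS'_A⟩ + ⟨S'_AΘS'_A⟩]·⟨ΘS_B S_B⟩`,
  Cauchy–Schwarz for the Gram form on the three-member family `(Θy_A, Θy'_A, y_B)`.

References: J. Fröhlich, R. Israel, E. H. Lieb, B. Simon, Comm. Math. Phys. 62 (1978) 1–34, §2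
[FILS1978]; S. Friedli, Y. Velenik, *Statistical Mechanics of Lattice Systems* (CUP 2017),
Lemma 10.8, Exercise 3.14 [FriedliVelenik2017]. No new definitions. The nine cubic mirror families
themselves are treated in the companion file `…ClusterMoveIneq.lean`.
-- ported from Cruxes/MoebiusLimitExists/Disproof.lean §G.1 (refuter-cdisprove gen 4)
-/

noncomputable section

open Filter Topology Set Function
open Literature.Probability.LatticeModels

namespace Summit.CriticalPhenomena.Ising3DConformalLimit.MoebiusLimitExistsOnlyInteraction

open MeasureTheory
open Summit.CriticalPhenomena.Ising3DConformalLimit.Cruxes.InversionUpgradeNormalised.FreeEndpointGaussianClosure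
  (isingExpect_sum_sum_mul_spinMonomial spinMonomial_append_apply)
open Summit.CriticalPhenomena.Ising3DConformalLimit.MoebiusLimitExistsNegative (criticalCorr_translate)

/-! ### Finite volume: site RP for a general involutive automorphism with an integer height -/

/-- **Finite-volume site-mirror RP for combinations of spin monomials, general mirror.** `θ` an
involutive automorphism of `ℤ^d`, `ℓ` an integer height with `ℓ ∘ θ = −ℓ`, `θ = id` on `{ℓ = 0}`
and `|ℓ x − ℓ y| ≤ 1` along edges; `Λ` a `θ`-stable finite volume; configurations `z^a` in the
closed half `{ℓ ≥ 0}`: `0 ≤ Σ_{a,b} c_a c_b ⟨∏ σ_{θ z^a ++ z^b}⟩^∅_{Λ;β,h}` (FILS site positivity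
H1–H3 for the half `P = {ℓ ≥ 0}`; the tree's `isingExpect_free_reflect_mul_self_nonneg`).
[cite: FILS1978, §2] -/
theorem sum_sum_mul_isingExpect_free_rp_nonneg {d : ℕ} (θ : Site d ≃ Site d)
    (hθ : Function.Involutive θ)
    (hθG : ∀ x y, (zdGraph d).Adj x y → (zdGraph d).Adj (θ x) (θ y))
    (ℓ : Site d → ℤ) (hℓθ : ∀ x, ℓ (θ x) = -ℓ x) (hfix : ∀ x, ℓ x = 0 → θ x = x)
    (hlip : ∀ x y, (zdGraph d).Adj x y → ℓ x ≤ ℓ y + 1 ∧ ℓ y ≤ ℓ x + 1)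
    {Λ : Finset (Site d)} (hΛ : ∀ x, x ∈ Λ ↔ θ x ∈ Λ) (β h : ℝ) {m : ℕ} (k : Fin m → ℕ)
    (z : (a : Fin m) → Fin (k a) → Site d) (c : Fin m → ℝ) (hz : ∀ a i, 0 ≤ ℓ (z a i)) :
    0 ≤ ∑ a, ∑ b, c a * c b * isingExpect (zdGraph d) Λ β h .free
      (spinMonomial (Fin.append (⇑θ ∘ z a) (z b))) := by
  classical
  let P : Set (Site d) := {x | 0 ≤ ℓ x}
  have hmemP : ∀ x, x ∈ P ↔ 0 ≤ ℓ x := fun x => Iff.rfl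
  have H1 : ∀ x, x ∈ P ∨ θ x ∈ P := fun x => by
    rw [hmemP, hmemP, hℓθ]; omega
  have H2 : ∀ x ∈ P, θ x ∈ P → θ x = x := fun x hx hθx => by
    rw [hmemP] at hx
    rw [hmemP, hℓθ] at hθx
    exact hfix x (by omega)
  have H3 : ∀ x y, (zdGraph d).Adj x y → (x ∈ P ∧ y ∈ P) ∨ (θ x ∈ P ∧ θ y ∈ P) :=
    fun x y hxy => by
      have h := hlip x y hxy
      rw [hmemP, hmemP, hmemP, hmemP, hℓθ, hℓθ]
      omega
  have hFm : Measurable fun σ : SpinConfig (Site d) => ∑ a, c a * spinMonomial (z a) σ :=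
    Finset.measurable_sum _ fun a _ => (measurable_spinMonomial (z a)).const_mul (c a)
  have hFP : DependsOn (fun σ : SpinConfig (Site d) => ∑ a, c a * spinMonomial (z a) σ) P := by
    intro σ σ' hσ
    refine Finset.sum_congr rfl fun a _ => ?_
    simp only [spinMonomial, spinAt]
    congr 1
    exact Finset.prod_congr rfl fun i _ => by rw [hσ (z a i) ((hmemP _).2 (hz a i))]
  have hFb : ∃ C, ∀ σ : SpinConfig (Site d), |∑ a, c a * spinMonomial (z a) σ| ≤ C := by
    refine ⟨∑ a, |c a|, fun σ => (Finset.abs_sum_le_sum_abs _ _).trans (Finset.sum_le_sum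
      fun a _ => ?_)⟩
    obtain ⟨A, hA⟩ := exists_spinMonomial_eq_spinProduct (z a)
    rw [abs_mul, hA]
    exact mul_le_of_le_one_right (abs_nonneg _) (abs_spinProduct_le_one A σ)
  have hpos := isingExpect_free_reflect_mul_self_nonneg (zdGraph d) θ hθ hθG hΛ H1 H2 H3 β h
    hFm hFP hFb
  have hexp : (fun σ : SpinConfig (Site d) => (∑ a, c a * spinMonomial (z a) (configReflect θ σ)) *
      ∑ a, c a * spinMonomial (z a) σ) = fun σ => ∑ a, ∑ b, c a * c b *
        spinMonomial (Fin.append (⇑θ ∘ z a) (z b)) σ := by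
    funext σ
    rw [Fintype.sum_mul_sum]
    refine Finset.sum_congr rfl fun a _ => Finset.sum_congr rfl fun b _ => ?_
    have hrefl : spinMonomial (z a) (configReflect θ σ) = spinMonomial (⇑θ ∘ z a) σ := rfl
    rw [spinMonomial_append_apply, hrefl]
    ring
  rw [hexp, isingExpect_sum_sum_mul_spinMonomial Λ β h .free (fun a b => c a * c b)] at hpos
  exact hpos

/-! ### Infinite volume at `β_c`, `d = 3` -/

/-- **Site-mirror RP of the critical `ℤ³` correlators, general mirror** (the registered anchor of
this file). For an involutive automorphism `θ` of `ℤ³` preserving the centred boxes and an integer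
height `ℓ` with `ℓ ∘ θ = −ℓ`, `θ = id` on `{ℓ = 0}`, `|ℓ x − ℓ y| ≤ 1` along edges:
`0 ≤ Σ_{a,b} c_a c_b ⟨∏ σ_{θ z^a ++ z^b}⟩_{β_c}` for configurations `z^a` in `{ℓ ≥ 0}` — the
finite-volume statement `sum_sum_mul_isingExpect_free_rp_nonneg` on the boxes and the box limit at
`β_c` (`criticalCorr_wellDefined_holds`). [cite: FILS1978, §2] -/
theorem rp_criticalCorr :
    ∀ (θ : Site 3 ≃ Site 3), Function.Involutive θ →
      (∀ x y, (zdGraph 3).Adj x y → (zdGraph 3).Adj (θ x) (θ y)) →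
      (∀ (L : ℕ) (x : Site 3), x ∈ box 3 L ↔ θ x ∈ box 3 L) →
      ∀ (ℓ : Site 3 → ℤ), (∀ x, ℓ (θ x) = -ℓ x) → (∀ x, ℓ x = 0 → θ x = x) →
        (∀ x y, (zdGraph 3).Adj x y → ℓ x ≤ ℓ y + 1 ∧ ℓ y ≤ ℓ x + 1) →
        ∀ (m : ℕ) (k : Fin m → ℕ) (z : (a : Fin m) → Fin (k a) → Site 3) (c : Fin m → ℝ),
          (∀ a i, 0 ≤ ℓ (z a i)) →
          0 ≤ ∑ a, ∑ b, c a * c b * criticalCorr 3 (k a + k b) (Fin.append (⇑θ ∘ z a) (z b)) := by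
  intro θ hθ hθG hbox ℓ hℓθ hfix hlip m k z c hz
  have hmem : (BoundaryCondition.free : BoundaryCondition (Site 3)) ∈
      ({.free, .plus, .minus} : Set (BoundaryCondition (Site 3))) := by simp
  have hT : Tendsto (fun L : ℕ => ∑ a, ∑ b, c a * c b *
      isingExpect (zdGraph 3) (box 3 L) (criticalBeta 3) 0 .free
        (spinMonomial (Fin.append (⇑θ ∘ z a) (z b))))
      atTop (𝓝 (∑ a, ∑ b, c a * c b * criticalCorr 3 (k a + k b) (Fin.append (⇑θ ∘ z a) (z b)))) :=
    tendsto_finsetSum _ fun a _ => tendsto_finsetSum _ fun b _ =>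
      (criticalCorr_wellDefined_holds (d := 3) (by norm_num) (k a + k b) _ .free hmem).const_mul _
  exact ge_of_tendsto' hT fun L => sum_sum_mul_isingExpect_free_rp_nonneg θ hθ hθG ℓ hℓθ hfix hlip
    (hbox L) (criticalBeta 3) 0 k z c hz

/-- **Invariance of the critical correlators under a box-preserving lattice automorphism** (the
finite-volume plus states along the boxes are invariant term by term, `isingCorr_map_equiv`).
[cite: FriedliVelenik2017, Exercise 3.14, p. 115] -/
theorem criticalCorr_comp_equiv (θ : Site 3 ≃ Site 3)
    (hadj : ∀ x y, (zdGraph 3).Adj (θ x) (θ y) ↔ (zdGraph 3).Adj x y)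
    (hbox : ∀ (L : ℕ) (x : Site 3), x ∈ box 3 L ↔ θ x ∈ box 3 L) {n : ℕ} (y : Fin n → Site 3) :
    criticalCorr 3 n (⇑θ ∘ y) = criticalCorr 3 n y := by
  classical
  obtain ⟨A, hA⟩ := exists_spinMonomial_eq_spinProduct y
  have hmap : spinMonomial (⇑θ ∘ y) = spinProduct (A.map θ.toEmbedding) := by
    funext s
    have h1 : spinMonomial (⇑θ ∘ y) s = spinMonomial y (s ∘ ⇑θ) := by
      simp [spinMonomial, spinAt]
    rw [h1, show spinMonomial y (s ∘ ⇑θ) = spinProduct A (s ∘ ⇑θ) from congrFun hA _]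
    simp [spinProduct, Finset.prod_map, spinAt]
  show plusExpect 3 (criticalBeta 3) 0 (spinMonomial (⇑θ ∘ y)) =
    plusExpect 3 (criticalBeta 3) 0 (spinMonomial y)
  rw [hmap, hA]
  show plusCorr 3 (criticalBeta 3) 0 (A.map θ.toEmbedding) = plusCorr 3 (criticalBeta 3) 0 A
  simp only [plusCorr, plusExpect]
  congr 1
  funext L
  exact isingCorr_map_equiv (zdGraph 3) θ hadj (hbox L) (criticalBeta 3) 0 .plus (fun _ => rfl) A

/-- Invariance of the critical correlators under an involutive map of `ℤ³` mapping neighbours to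
neighbours and boxes into boxes (such a map is a box-preserving automorphism).
[cite: FriedliVelenik2017, Exercise 3.14, p. 115] -/
theorem criticalCorr_comp_involutive {Θ : Site 3 → Site 3} (hΘ : Function.Involutive Θ)
    (hΘG : ∀ x y, (zdGraph 3).Adj x y → (zdGraph 3).Adj (Θ x) (Θ y))
    (hbox : ∀ (L : ℕ) (x : Site 3), x ∈ box 3 L → Θ x ∈ box 3 L) {n : ℕ} (y : Fin n → Site 3) :
    criticalCorr 3 n (Θ ∘ y) = criticalCorr 3 n y := by
  have hbox' : ∀ (L : ℕ) (x : Site 3), x ∈ box 3 L ↔ Θ x ∈ box 3 L := fun L x =>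
    ⟨hbox L x, fun h => by simpa [hΘ x] using hbox L (Θ x) h⟩
  have hadj : ∀ x y, (zdGraph 3).Adj (Θ x) (Θ y) ↔ (zdGraph 3).Adj x y := fun x y =>
    ⟨fun h => by simpa [hΘ x, hΘ y] using hΘG _ _ h, hΘG x y⟩
  exact criticalCorr_comp_equiv (hΘ.toPerm Θ) hadj hbox' y

/-- Site-mirror RP of the critical correlators for an involutive map of `ℤ³` mapping neighbours to
neighbours and boxes into boxes, with an integer height (`rp_criticalCorr` repackaged).
[cite: FILS1978, §2] -/
theorem rp_of_involutive {Θ : Site 3 → Site 3} (hΘ : Function.Involutive Θ)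
    (hΘG : ∀ x y, (zdGraph 3).Adj x y → (zdGraph 3).Adj (Θ x) (Θ y))
    (hbox : ∀ (L : ℕ) (x : Site 3), x ∈ box 3 L → Θ x ∈ box 3 L)
    (ℓ : Site 3 → ℤ) (hℓΘ : ∀ x, ℓ (Θ x) = -ℓ x) (hfix : ∀ x, ℓ x = 0 → Θ x = x)
    (hlip : ∀ x y, (zdGraph 3).Adj x y → ℓ x ≤ ℓ y + 1 ∧ ℓ y ≤ ℓ x + 1)
    {m : ℕ} (k : Fin m → ℕ) (z : (a : Fin m) → Fin (k a) → Site 3) (c : Fin m → ℝ)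
    (hz : ∀ a i, 0 ≤ ℓ (z a i)) :
    0 ≤ ∑ a, ∑ b, c a * c b * criticalCorr 3 (k a + k b) (Fin.append (Θ ∘ z a) (z b)) := by
  have hbox' : ∀ (L : ℕ) (x : Site 3), x ∈ box 3 L ↔ Θ x ∈ box 3 L := fun L x =>
    ⟨hbox L x, fun h => by simpa [hΘ x] using hbox L (Θ x) h⟩
  exact rp_criticalCorr (hΘ.toPerm Θ) hΘ hΘG hbox' ℓ hℓΘ hfix hlip m k z c hz

/-! ### All heights: conjugation by a lattice translation -/

/-- Translating a concatenated configuration translates both blocks. [folklore] -/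
theorem append_add_const {a b : ℕ} (u : Fin a → Site 3) (v : Fin b → Site 3) (w : Site 3) :
    (fun i => Fin.append u v i + w) = Fin.append (fun j => u j + w) (fun j => v j + w) := by
  funext i
  refine Fin.addCases (fun j => ?_) (fun j => ?_) i
  · simp [Fin.append_left]
  · simp [Fin.append_right]

/-- Invariance of the critical correlators passes from `Θ` to the conjugate `v ↦ Θ (v − w) + w` by
a lattice translation (`criticalCorr_translate`). [folklore] -/
theorem criticalCorr_conj_translate {Θ : Site 3 → Site 3}
    (hsym : ∀ (n : ℕ) (y : Fin n → Site 3), criticalCorr 3 n (Θ ∘ y) = criticalCorr 3 n y)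
    (w : Site 3) (n : ℕ) (y : Fin n → Site 3) :
    criticalCorr 3 n ((fun v => Θ (v - w) + w) ∘ y) = criticalCorr 3 n y := by
  show criticalCorr 3 n (fun i => Θ (y i - w) + w) = criticalCorr 3 n y
  rw [criticalCorr_translate (fun i => Θ (y i - w)) w,
    show (fun i => Θ (y i - w)) = Θ ∘ (fun i => y i - w) from rfl, hsym n (fun i => y i - w)]
  have h3 := criticalCorr_translate y (-w)
  simpa [sub_eq_add_neg] using h3

/-- Reflection positivity passes from `(Θ, φ)` to the conjugate mirror `v ↦ Θ (v − w) + w` with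
height `φ (· − w)` (`criticalCorr_translate`). [folklore] -/
theorem rp_conj_translate {Θ : Site 3 → Site 3} {φ : Site 3 → ℤ}
    (hRP : ∀ (m : ℕ) (k : Fin m → ℕ) (z : (a : Fin m) → Fin (k a) → Site 3) (c : Fin m → ℝ),
      (∀ a j, 0 ≤ φ (z a j)) →
      0 ≤ ∑ a, ∑ b, c a * c b * criticalCorr 3 (k a + k b) (Fin.append (Θ ∘ z a) (z b)))
    (w : Site 3) {m : ℕ} (k : Fin m → ℕ) (z : (a : Fin m) → Fin (k a) → Site 3) (c : Fin m → ℝ)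
    (hz : ∀ a j, 0 ≤ φ (z a j - w)) :
    0 ≤ ∑ a, ∑ b, c a * c b *
      criticalCorr 3 (k a + k b) (Fin.append ((fun v => Θ (v - w) + w) ∘ z a) (z b)) := by
  have h0 := hRP m k (fun a j => z a j - w) c (fun a j => hz a j)
  refine le_of_le_of_eq h0 (Finset.sum_congr rfl fun a _ => Finset.sum_congr rfl fun b _ => ?_)
  congr 1
  have ht := criticalCorr_translate (Fin.append (Θ ∘ fun j => z a j - w) (fun j => z b j - w)) w
  rw [append_add_const] at ht
  rw [← ht]
  congr 1
  funext i
  refine Fin.addCases (fun j => ?_) (fun j => ?_) i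
  · simp [Fin.append_left]
  · simp [Fin.append_right]

/-! ### The cluster move inequality for an RP mirror -/

/-- Block swap: `⟨Π_{u ++ v}⟩ = ⟨Π_{v ++ u}⟩`. [folklore] -/
theorem criticalCorr_append_comm {a b : ℕ} (u : Fin a → Site 3) (v : Fin b → Site 3) :
    criticalCorr 3 (a + b) (Fin.append u v) = criticalCorr 3 (b + a) (Fin.append v u) := by
  show plusExpect 3 (criticalBeta 3) 0 (spinMonomial (Fin.append u v)) =
    plusExpect 3 (criticalBeta 3) 0 (spinMonomial (Fin.append v u))
  congr 1
  funext s
  unfold spinMonomial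
  rw [Fin.prod_univ_add, Fin.prod_univ_add]
  simp only [Fin.append_left, Fin.append_right]
  ring

/-- Composition distributes over `Fin.append`. [folklore] -/
theorem comp_append {a b : ℕ} (Θ : Site 3 → Site 3) (u : Fin a → Site 3) (v : Fin b → Site 3) :
    Θ ∘ Fin.append u v = Fin.append (Θ ∘ u) (Θ ∘ v) := by
  funext j
  refine Fin.addCases (fun j => ?_) (fun j => ?_) j
  · simp [Fin.append_left]
  · simp [Fin.append_right]

/-- Discriminant of a nonnegative binary quadratic form. [folklore] -/
theorem sq_le_mul_of_quadratic_nonneg {α β γ : ℝ}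
    (h : ∀ l m : ℝ, 0 ≤ l ^ 2 * α + 2 * l * m * β + m ^ 2 * γ) : β ^ 2 ≤ α * γ := by
  have hα : 0 ≤ α := by simpa using h 1 0
  have hγ : 0 ≤ γ := by simpa using h 0 1
  have h1 := h γ (-β)
  have h2 := h β (-α)
  rcases lt_or_ge 0 γ with hγ' | hγ'
  · nlinarith
  rcases lt_or_ge 0 α with hα' | hα'
  · nlinarith
  have hα0 : α = 0 := le_antisymm hα' hα
  have hγ0 : γ = 0 := le_antisymm hγ' hγ
  have h3 := h 1 (-β)
  rw [hα0, hγ0] at h3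
  nlinarith

/-- **CLUSTER MOVE INEQUALITY for an RP mirror.** `Θ` involutive, `φ ∘ Θ = −φ`, `criticalCorr`
`Θ`-invariant and the Gram form `(z, z') ↦ ⟨∏σ_{Θz} ∏σ_{z'}⟩_{β_c}` PSD on monomials supported in
`{φ ≥ 0}`; then for a cluster `y_A ⊆ {φ ≤ 0}`, a block `y_B ⊆ {φ ≥ 0}` and `y'_A` differing from
`y_A` only at `i` (still `φ (y'_A i) ≤ 0`):
`(⟨Πσ_{y_A}Πσ_{y_B}⟩ − ⟨Πσ_{y'_A}Πσ_{y_B}⟩)² ≤ [⟨S_AΘS_A⟩ − 2⟨S_AΘS'_A⟩ + ⟨S'_AΘS'_A⟩]·⟨ΘS_B S_B⟩`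
— Cauchy–Schwarz for the Gram form on the three-member family `(Θy_A, Θy'_A, y_B)` with
coefficients `(l, −l, m)`. [cite: FILS1978, §2] -/
theorem clusterMoveIneq_of_rp {Θ : Site 3 → Site 3} {φ : Site 3 → ℤ}
    (hinv : ∀ v, Θ (Θ v) = v) (hφ : ∀ v, φ (Θ v) = -φ v)
    (hsym : ∀ (n : ℕ) (y : Fin n → Site 3), criticalCorr 3 n (Θ ∘ y) = criticalCorr 3 n y)
    (hRP : ∀ (m : ℕ) (k : Fin m → ℕ) (z : (a : Fin m) → Fin (k a) → Site 3) (c : Fin m → ℝ),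
      (∀ a j, 0 ≤ φ (z a j)) →
      0 ≤ ∑ a, ∑ b, c a * c b * criticalCorr 3 (k a + k b) (Fin.append (Θ ∘ z a) (z b)))
    {a b : ℕ} {i : Fin a} {yA yA' : Fin a → Site 3} {yB : Fin b → Site 3}
    (hdiff : ∀ j, j ≠ i → yA' j = yA j) (hA : ∀ j, φ (yA j) ≤ 0) (hAi : φ (yA' i) ≤ 0)
    (hB : ∀ j, 0 ≤ φ (yB j)) :
    (criticalCorr 3 (a + b) (Fin.append yA yB) - criticalCorr 3 (a + b) (Fin.append yA' yB)) ^ 2 ≤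
      (criticalCorr 3 (a + a) (Fin.append yA (Θ ∘ yA))
        - 2 * criticalCorr 3 (a + a) (Fin.append yA (Θ ∘ yA'))
        + criticalCorr 3 (a + a) (Fin.append yA' (Θ ∘ yA'))) *
      criticalCorr 3 (b + b) (Fin.append (Θ ∘ yB) yB) := by
  have hΘΘ : ∀ {n : ℕ} (y : Fin n → Site 3), Θ ∘ (Θ ∘ y) = y := fun y => funext fun j => hinv (y j)
  have hA' : ∀ j, φ (yA' j) ≤ 0 := by
    intro j
    by_cases hj : j = i
    · subst hj; exact hAi
    · rw [hdiff j hj]; exact hA j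
  -- the three-member family and its positivity
  let k : Fin 3 → ℕ := ![a, a, b]
  let z : (j : Fin 3) → Fin (k j) → Site 3 := fun j =>
    match j with
    | ⟨0, _⟩ => Θ ∘ yA
    | ⟨1, _⟩ => Θ ∘ yA'
    | ⟨2, _⟩ => yB
  have hz : ∀ j t, 0 ≤ φ (z j t) := by
    intro j t
    match j, t with
    | ⟨0, _⟩, t => show 0 ≤ φ (Θ (yA t)); rw [hφ]; linarith [hA t]
    | ⟨1, _⟩, t => show 0 ≤ φ (Θ (yA' t)); rw [hφ]; linarith [hA' t]
    | ⟨2, _⟩, t => exact hB t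
  -- Gram entries
  set g00 := criticalCorr 3 (a + a) (Fin.append yA (Θ ∘ yA)) with hg00
  set g01 := criticalCorr 3 (a + a) (Fin.append yA (Θ ∘ yA')) with hg01
  set g11 := criticalCorr 3 (a + a) (Fin.append yA' (Θ ∘ yA')) with hg11
  set g02 := criticalCorr 3 (a + b) (Fin.append yA yB) with hg02
  set g12 := criticalCorr 3 (a + b) (Fin.append yA' yB) with hg12
  set g22 := criticalCorr 3 (b + b) (Fin.append (Θ ∘ yB) yB) with hg22
  -- symmetries
  have hg10 : criticalCorr 3 (a + a) (Fin.append yA' (Θ ∘ yA)) = g01 := by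
    rw [← hsym, comp_append, hΘΘ, criticalCorr_append_comm]
  have hg20 : criticalCorr 3 (b + a) (Fin.append (Θ ∘ yB) (Θ ∘ yA)) = g02 := by
    rw [← comp_append, hsym, criticalCorr_append_comm]
  have hg21 : criticalCorr 3 (b + a) (Fin.append (Θ ∘ yB) (Θ ∘ yA')) = g12 := by
    rw [← comp_append, hsym, criticalCorr_append_comm]
  have hQ : ∀ l m : ℝ,
      0 ≤ l ^ 2 * (g00 - 2 * g01 + g11) + 2 * l * m * (g02 - g12) + m ^ 2 * g22 := by
    intro l m
    have h := hRP 3 k z ![l, -l, m] hz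
    rw [Fin.sum_univ_three] at h
    simp only [Fin.sum_univ_three] at h
    have h' : 0 ≤ l * l * criticalCorr 3 (a + a) (Fin.append (Θ ∘ (Θ ∘ yA)) (Θ ∘ yA))
        + l * (-l) * criticalCorr 3 (a + a) (Fin.append (Θ ∘ (Θ ∘ yA)) (Θ ∘ yA'))
        + l * m * criticalCorr 3 (a + b) (Fin.append (Θ ∘ (Θ ∘ yA)) yB)
        + ((-l) * l * criticalCorr 3 (a + a) (Fin.append (Θ ∘ (Θ ∘ yA')) (Θ ∘ yA))
          + (-l) * (-l) * criticalCorr 3 (a + a) (Fin.append (Θ ∘ (Θ ∘ yA')) (Θ ∘ yA'))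
          + (-l) * m * criticalCorr 3 (a + b) (Fin.append (Θ ∘ (Θ ∘ yA')) yB))
        + (m * l * criticalCorr 3 (b + a) (Fin.append (Θ ∘ yB) (Θ ∘ yA))
          + m * (-l) * criticalCorr 3 (b + a) (Fin.append (Θ ∘ yB) (Θ ∘ yA'))
          + m * m * criticalCorr 3 (b + b) (Fin.append (Θ ∘ yB) yB)) := h
    rw [hΘΘ, hΘΘ, hg10, hg20, hg21] at h'
    nlinarith [h']
  have := sq_le_mul_of_quadratic_nonneg hQ
  linarith [this]

end Summit.CriticalPhenomena.Ising3DConformalLimit.MoebiusLimitExistsOnlyInteraction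

end
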